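import Literature.NumberTheory.EllipticCurves.Rank1Residual.Typed.CasselsLowerBound
import HarnessLib

/-!
# The LOWER half `hlow` from a 2-power LEVEL datum at analytic rank `0` (cell `b2b-bsdres`, unit `b2b-bsdres-sha-1`, gen 13)

HONEST FRAMING (cell `b2b-bsdres-*`, verbatim): prove what is provable now; shrink each hard class to its core
with data; no claim beyond stated classes. X5 (`p = 2`, every `E`) stays CONSTRUCTION-SHAPED; nothing is booked;
THEOREMS ONLY (no definition, no new named fact).

**What.** The α-go END-STATE consumer for class X5 at `p = 2`
(`Summit.BirchSwinnertonDyer.Rank1Residual.X5.O1.bsdp_two_of_prop514_of_lowerBound_auto`,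
`Summits/…/X5/TwoAdicTargetsAlphaAuto.lean`) takes, besides PRINT binders and the period normaliser
`hper₀`, ONE per-pair arithmetic input `hlow : MissingLowerBoundAt W 2` = `ord₂ #Ш(E/ℚ)_an ≤ ord₂ #Ш(E/ℚ)`
(`Typed/Basic.lean`) — the DESCENT half (a lower bound on `#Ш`). At analytic rank `0` that half is a
FINITE CERTIFICATE: with `#Ш(E/ℚ)_an = q`, `ord_p q ≤ 2k`, the datum `p^(2k-1) ∣ #Ш(E/ℚ)` gives `hlow`
by Cassels–Tate squareness (`missingLowerBoundAt_of_casselsTate_of_pow_dvd`, this directory) once `Ш`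
is finite, and finiteness is Gross–Zagier–Kolyvagin (`hGZK` = bsd.S17, already a binder of the consumer).
This file WIRES exactly that, so that a records-module row can discharge `hlow` by ONE term:
* `missingLowerBoundAt_of_GZK_of_pow_dvd` — any prime `p`: `hCT`, `hGZK`, `r_an = 0`, `hq`, `hv`, `hdvd`
  ⇒ `MissingLowerBoundAt W p`;
* `missingLowerBoundAt_two_of_shaAn_eq_64_of_dvd` — the shape met on the `K = 3` level-census
  population at `p = 2` (`#Ш_an = 64`): `2^5 ∣ #Ш(E/ℚ)` ⇒ `MissingLowerBoundAt W 2`;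
* `missingLowerBoundAt_two_of_shaAn_eq_16_of_dvd` — the `K = 2` shape (`#Ш_an = 16`): `2^3 ∣ #Ш(E/ℚ)`
  ⇒ `MissingLowerBoundAt W 2`.
With either of the last two in hand, `bsdp_two_of_prop514_of_lowerBound_auto … hlow : BSDp W 2`.

**Where the datum comes from (records; READ by the lane, never proved here).** On the 325 curves of the
`K ≥ 3` resistant population below `5·10⁵` (`Summits/…/X5/LevelRecords{,B,C}.lean`: `dim Sel₂ = t + 2`
by two engines; Cassels–Tate split `s = 0` ⟂ engine F's explicit all-lift, so `Ш[2] ≅ (ℤ/2)²` and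
`Ш[2] ⊂ 2Ш[4]`), engine G's Cassels–Tate `⟨x₄, y⟩` on `Sel₄ × Sel₂` determines `m = 0` on 323 of them
(`X5/LevelRecordsG.lean`, `X5/LevelRecordsG9.lean`: `gM = 0` ⇒ `Ш[4] ⊂ 2Ш[8]`, `#Ш[8] = 64`,
`ord₂ #Ш ≥ 6`; one engine at that step, every valued bit `0`) — among them the o1 pilot pair
`97149c1/c2`, `496461d1/d2` (`LevelRecordsG9` rows `⟨"97149c1", 97149, 1, 6, 3, 16, 18, 0⟩`,
`⟨"97149c2", 97149, 1, 6, 3, 18, 18, 0⟩`, `⟨"496461d1", 496461, 1, 6, 3, 18, 18, 0⟩`,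
`⟨"496461d2", 496461, 1, 6, 3, 15, 18, 0⟩`). On the 5 004 `K = 2` class representatives the exact
level-2 datum stands by engines A/B/F + G (`X5/ClosureRecordsK2*.lean`). Those rows are EVIDENCE-grade
records: the binder `hdvd` below is where such a record is read. ENGINE I's level-(8,2) bit
(`Ш[16] = Ш[8]`) is NOT on this path — it is the exactness side, which α-go takes from Prop. 5.14 + Kato.

References: Cassels 1962 [Cassels1962ArithmeticIV]; Silverman AEC X.4.14 [SilvermanAEC2009]; Miller 2011
Def. 1.1 [Miller2011LMS]; cell files `b2b-bsdres-sha-1/SHA-CENSUS.md` §8, `b2b-bsdres-sha-1/X5-ROUTE.md` §2,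
`cells/o1/PLAN.md` C171 (d) D34 / C173 (f).
-/

noncomputable section

open scoped Classical

open WeierstrassCurve Literature.NumberTheory.EllipticCurves
  Literature.NumberTheory.EllipticCurves.Rank1Residual

namespace Literature.NumberTheory.EllipticCurves.Rank1Residual.Typed

variable (W : WeierstrassCurve ℚ) [W.IsElliptic]

/-- **`hlow` from a level datum, any prime (PROVED).** At analytic rank `0`, granted the Cassels–Tate
pairing (`hCT` = bsd.S18) and Gross–Zagier–Kolyvagin (`hGZK` = bsd.S17, giving `Ш(E/ℚ)` finite): if
`#Ш(E/ℚ)_an` is a rational `q` with `ord_p q ≤ 2k` and `p^(2k-1) ∣ #Ш(E/ℚ)`, then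
`MissingLowerBoundAt W p` (`ord_p #Ш_an ≤ ord_p #Ш`). Wiring of
`missingLowerBoundAt_of_casselsTate_of_pow_dvd`. [cite: SilvermanAEC2009, Thm. X.4.14]
[cite: Miller2011LMS, Def. 1.1 (arXiv:1010.2431 p. 3)] -/
theorem missingLowerBoundAt_of_GZK_of_pow_dvd (p : ℕ) [Fact p.Prime]
    (hCT : exists_casselsTate_pairing (K := ℚ))
    (hGZK : rank_eq_analyticRank_of_analyticRank_le_one) (hr : W.analyticRank = 0)
    {q : ℚ} (hq : shaAn W = (q : ℂ)) {k : ℕ} (hv : padicValRat p q ≤ 2 * k)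
    (hdvd : p ^ (2 * k - 1) ∣ W.shaOrder) : MissingLowerBoundAt W p :=
  missingLowerBoundAt_of_casselsTate_of_pow_dvd W p hCT (hGZK W (by omega)).2 hq hv hdvd

/-- **The `K = 3` shape at `p = 2` (PROVED): `#Ш(E/ℚ)_an = 64` and `2^5 ∣ #Ш(E/ℚ)` ⇒ `hlow`.** The
datum `2^5 ∣ #Ш` (indeed `2^6`) is what a level-3 2-power descent record states (`Ш[2] ≅ (ℤ/2)²`,
`Ш[2] ⊂ 2Ш[4]`, `Ш[4] ⊂ 2Ш[8]`, so `#Ш[8] = 64`); here it is a binder, read by the lane from records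
(`X5/LevelRecordsG.lean`, `X5/LevelRecordsG9.lean`), never proved in this file.
[cite: SilvermanAEC2009, Thm. X.4.14] [cite: Miller2011LMS, Def. 1.1] -/
theorem missingLowerBoundAt_two_of_shaAn_eq_64_of_dvd
    (hCT : exists_casselsTate_pairing (K := ℚ))
    (hGZK : rank_eq_analyticRank_of_analyticRank_le_one) (hr : W.analyticRank = 0)
    (hq : shaAn W = ((64 : ℚ) : ℂ)) (hdvd : 2 ^ 5 ∣ W.shaOrder) : MissingLowerBoundAt W 2 := by
  have h64 : padicValRat 2 (64 : ℚ) ≤ 2 * (3 : ℕ) := by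
    rw [show (64 : ℚ) = ((2 ^ 6 : ℕ) : ℚ) by norm_num, padicValRat.of_nat, padicValNat.prime_pow]
    norm_num
  exact missingLowerBoundAt_of_GZK_of_pow_dvd W 2 hCT hGZK hr hq (k := 3) h64 (by simpa using hdvd)

/-- **The `K = 2` shape at `p = 2` (PROVED): `#Ш(E/ℚ)_an = 16` and `2^3 ∣ #Ш(E/ℚ)` ⇒ `hlow`.** The
datum `2^3 ∣ #Ш` (indeed `2^4`) is what a level-2 2-power descent record states (`Ш[2] ≅ (ℤ/2)²`,
`Ш[2] ⊂ 2Ш[4]`, so `#Ш[4] = 16`); a binder, read by the lane from records (`X5/LevelRecords*.lean`,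
`X5/ClosureRecordsK2*.lean`), never proved in this file. [cite: SilvermanAEC2009, Thm. X.4.14]
[cite: Miller2011LMS, Def. 1.1] -/
theorem missingLowerBoundAt_two_of_shaAn_eq_16_of_dvd
    (hCT : exists_casselsTate_pairing (K := ℚ))
    (hGZK : rank_eq_analyticRank_of_analyticRank_le_one) (hr : W.analyticRank = 0)
    (hq : shaAn W = ((16 : ℚ) : ℂ)) (hdvd : 2 ^ 3 ∣ W.shaOrder) : MissingLowerBoundAt W 2 := by
  have h16 : padicValRat 2 (16 : ℚ) ≤ 2 * (2 : ℕ) := by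
    rw [show (16 : ℚ) = ((2 ^ 4 : ℕ) : ℚ) by norm_num, padicValRat.of_nat, padicValNat.prime_pow]
    norm_num
  exact missingLowerBoundAt_of_GZK_of_pow_dvd W 2 hCT hGZK hr hq (k := 2) h16 (by simpa using hdvd)

end Literature.NumberTheory.EllipticCurves.Rank1Residual.Typed

end
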